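import Literature.MathematicalPhysics.QuantumLattice.HubbardOpenBoxGeneralPairClusterOracle
import HarnessLib

/-!
# The general-pair cluster oracle with a precomputed hop list (sparse bond graphs)

Topic `MathematicalPhysics/QuantumLattice`, family `hubbard`. `gpCluster a b W V M` (`HubbardOpenBoxGeneralPairClusterOracle`)
applies the general-pair cluster Hamiltonian `h^G(W/Q, V/Q, M/Q)` to a coded vector through the ALL-PAIRS hop list
`hopOrbsW W neAdjCode (ab)` — `2·ab·(ab−1)` hopping words per configuration, whatever the bond graph. For a sparse graph on many
sites (the 21 bonds of the twelve-site `Cu₄O₈` block against 264 ordered orbital pairs) this file supplies the same oracle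
with the hop list restricted to the support of `W` and PRECOMPUTED: **`listCluster N orbs V M bound`** (Lin–Gubernatis 1993 §II:
the bond table is tabulated once), the support lemma `openBoxHopApplyW_eq_of_support` (an adjacency containing the support of
`W` gives the same coded application as all pairs), and **`listCluster_models`**: with `W` symmetric, vanishing off `adj` and on
the diagonal, and `hopOrbsW W adj (ab) = orbs` (kernel-decided by the instance), `listCluster (ab) orbs V M (hzBoundW …)` models
`hubbardOpenBoxGP a b (W/Q) (V/Q) (M/Q)` exactly as `gpCluster` does — so the generic certificate / Rayleigh chains
(`KCert.soundG`, `CoefTree.star_vec_dotProduct_mulVec`) run at the cost of the actual bonds.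

Everything is proved; no named fact; nothing numerical is asserted here.

## References

* H. Q. Lin, J. E. Gubernatis, Comput. Phys. 7 (1993) 400, §II. [cite: LinGubernatis1993, §II]
* R. Valentí, J. Stolze, P. J. Hirschfeld, Phys. Rev. B 43 (1991) 13743, §II. [cite: ValentiStolzeHirschfeld1991, §II]
-/

noncomputable section

namespace Literature.MathematicalPhysics.QuantumLattice

namespace OccupationCode

open Finset Matrix ClusterLowerBound

/-- **THE GENERAL-PAIR ORACLE WITH A PRECOMPUTED HOP LIST**: coded application of `Q·h^G` through the orbital hop list `orbs`
(`= hopOrbsW W adj N` for an adjacency containing the support of `W`), weighted double occupancy and potential by the tables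
`V`, `M`; `bound` the a-priori entry bound. [cite: LinGubernatis1993, §II] -/
def listCluster (N : ℕ) (orbs : List (ℕ × ℕ × ℤ)) (V M : ℕ → ℤ) (bound : ℕ) : CodedCluster where
  app m f := -hopListSumW m f orbs + (doccOfW V N m + densOfW M N m) * f m
  bound := bound

/-- **Support lemma**: if `W` vanishes off `adj` and on the diagonal, the coded hopping application through `adj` equals the
all-pairs one. [cite: LinGubernatis1993, §II] -/
theorem openBoxHopApplyW_eq_of_support (W : ℕ → ℕ → ℤ) (adj : ℕ → ℕ → Bool) (hoff : ∀ P Q, adj P Q = false → W P Q = 0)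
    (hdiag : ∀ P, W P P = 0) (N m : ℕ) (f : ℕ → ℤ) :
    openBoxHopApplyW W adj N m f = openBoxHopApplyW W neAdjCode N m f := by
  rw [openBoxHopApplyW, openBoxHopApplyW, sumNat_eq, sumNat_eq]
  refine Finset.sum_congr rfl fun P _ => ?_
  rw [sumNat_eq, sumNat_eq]
  refine Finset.sum_congr rfl fun Q _ => ?_
  by_cases hPQ : P = Q
  · subst hPQ
    have h1 : neAdjCode P P = false := by simp [neAdjCode]
    simp [h1, hdiag]
  · have h1 : neAdjCode P Q = true := by simpa [neAdjCode] using hPQ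
    rw [h1, if_pos rfl]
    by_cases ha : adj P Q = true
    · rw [if_pos ha]
    · rw [if_neg ha, hoff P Q (Bool.eq_false_iff.2 ha)]; simp

section Box

variable {a b : ℕ}

/-- **SEMANTICS OF THE HOP-LIST ORACLE**: for `W` symmetric, vanishing off `adj` and on the diagonal, and the hop list
`orbs = hopOrbsW W adj (ab)`, `listCluster (ab) orbs V M (hzBoundW (ab) W V M)` models `h^G(W/Q, V/Q, M/Q)` with the coded
entries `hzIntGP`. [cite: LinGubernatis1993, §II] [cite: ValentiStolzeHirschfeld1991, §II] -/
theorem listCluster_models (W : ℕ → ℕ → ℤ) (hW : ∀ P Q, W P Q = W Q P) (adj : ℕ → ℕ → Bool)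
    (hoff : ∀ P Q, adj P Q = false → W P Q = 0) (hdiag : ∀ P, W P P = 0) (V M : ℕ → ℤ) (Q : ℕ)
    {orbs : List (ℕ × ℕ × ℤ)} (horbs : hopOrbsW W adj (a * b) = orbs) :
    (listCluster (a * b) orbs V M (hzBoundW (a * b) W V M)).Models a b (hzIntGP a b W V M) Q
      (hubbardOpenBoxGP a b (fun x y => (W (siteRank x) (siteRank y) : ℝ) / Q) (fun x => (V (siteRank x) : ℝ) / Q)
        (fun x => (M (siteRank x) : ℝ) / Q)) where
  apply_eq := (gpCluster_models W hW V M Q).apply_eq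
  mulVec_eq f s := by
    rw [(gpCluster_models (a := a) (b := b) W hW V M Q).mulVec_eq f s]
    have happ : (gpCluster a b W V M).app (code s) f = (listCluster (a * b) orbs V M (hzBoundW (a * b) W V M)).app (code s) f := by
      show -hopListSumW (code s) f (hopOrbsW W neAdjCode (a * b)) + (doccOfW V (a * b) (code s) + densOfW M (a * b) (code s)) * f (code s) =
        -hopListSumW (code s) f orbs + (doccOfW V (a * b) (code s) + densOfW M (a * b) (code s)) * f (code s)
      rw [← horbs, hopListSumW_hopOrbsW, hopListSumW_hopOrbsW, openBoxHopApplyW_eq_of_support W adj hoff hdiag]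
    rw [happ]
  preserves := (gpCluster_models W hW V M Q).preserves
  symm := (gpCluster_models W hW V M Q).symm
  abs_le := (gpCluster_models (a := a) (b := b) W hW V M Q).abs_le

end Box

end OccupationCode

end Literature.MathematicalPhysics.QuantumLattice

end
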